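import Mathlib
import HarnessLib
import Summits.CriticalPhenomena.CardyFormulaZ2.Theorems.CardyComplexConeEdgeCoherenceLeeYangClassDefs

/-!
# Sub-goals `classGF_zeta0_eq_cornerObs`, `classGF_one_eq_passageProb` of line `Sketch` (composition `LeeYang`)
# for crux `CardyComplexCone.EdgeCoherence`

Route `CardyComplexCone` (sub-problem `CriticalPhenomena/CardyFormulaZ2`), crux
`Summit.CriticalPhenomena.CardyFormulaZ2.Theses.CardyComplexCone.EdgeCoherence` (item stmt-CriticalPhenomena-11385).
Helper file `--supports stmt-CriticalPhenomena-11385`: it proves, by name, the two registered sub-goals of line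
`Sketch` about the class generating function `classGF` (module `…LeeYangClassDefs`):

* `classGF_zeta0_eq_cornerObs` — **at the physical fugacity the class generating function IS the corner
  observable**: for admissible data and a nonzero reading mesh,
  `classGF E δ v c ζ₀ = cornerObs E δ v (faceAt v c)`. Along the exploration orbit both integrands are sums over the orbit hits of `(v, c)` before the exit
  (`classGF_eq_integral_orbit`, `dartPhaseSum_faceAt_eq`), and termwise `orbitPhase n = ζ₀ ^ T_n`
  (`orbitPhase_eq_zeta0_zpow`: every step turns by `±π/2`, so `exp(−(i/3)W) = ζ₀^{W/(π/2)}` exactly).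
* `classGF_one_eq_passageProb` — **at unit fugacity the class generating function is the passage probability**:
  `classGF E δ v c 1 = P[γ traverses the dart (v, faceAt v c)]` (any reading mesh). At `ζ = 1` every term is `1`,
  so the integrand is the number of positions `k` at which `γ` traverses the dart; the exploration never repeats a
  medial edge (`IsMedialExploration.nodup`), so this number is `0` or `1` (`card_dartFilter_le_one`), i.e. the
  indicator of the passage event, whose integral is its probability (the event reads only the finitely many edges
  of `Ω_δ`, hence is measurable, `measurable_of_forall_inter`).

Sources: H. Duminil-Copin, S. Smirnov, *Conformal invariance of lattice models*, Clay Math. Proc. 15 (2012) §8;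
S. Smirnov, Ann. of Math. 172 (2010) §2.2 (face index ≡ number of turns); lead analysis
`Cruxes/EdgeCoherence/Lines/Sketch-LeeYang.md` §1. Everything is proved inline.
-/

noncomputable section

namespace Summit.CriticalPhenomena.CardyFormulaZ2.Cruxes.EdgeCoherence.LeeYang

open scoped BigOperators Topology
open Filter Set MeasureTheory
open Literature.Probability.LatticeModels Literature.Probability.RandomPlanarGeometry
open Literature.Probability.Percolation (BondConfig bondPercolation half)
open Summit.CriticalPhenomena.CardyFormulaZ2.Cruxes.EdgeCoherence.FixedRadiusCut
  (cornerObs startCorner orbitPhase isStartCorner_startCorner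
    medialExploration_inter_edgeSet edgeSet_finite measurable_of_forall_inter integrable_of_forall_inter)
open Summit.CriticalPhenomena.CardyFormulaZ2.Theorems.EdgeCoherence.Negative (dartPhaseSum)

/-! ### Sub-goal 1: the physical fugacity -/

/-- **Sub-goal `classGF_zeta0_eq_cornerObs`** (registered sub-goal of line `Sketch`, composition `LeeYang`): for
admissible data and a nonzero reading mesh, the class-`c` generating function at the physical fugacity
`ζ₀ = exp(−iπ/6)` is the corner observable at the corner `(v, faceAt v c)`: both are the integral of the sum, over
the orbit hits `n` of `(v, c)` before the exit, of `orbitPhase n = ζ₀ ^ T_n`. -/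
theorem classGF_zeta0_eq_cornerObs : ∀ (E : DiscreteDobrushin) (δ : ℝ) (v : Site 2) (c : Fin 4), E.IsZdAdmissible → δ ≠ 0 → classGF E δ v c zeta0 = cornerObs E δ v (faceAt v c) := by
  intro E δ v c hE hδ
  have h : cornerObs E δ v (faceAt v c) =
      ∫ ω, dartPhaseSum (medialExploration E ω) δ v (faceAt v c) ∂(bondPercolation (zdGraph 2) half) := rfl
  rw [h, classGF_eq_integral_orbit hE hδ]
  refine integral_congr_ae (ae_of_all _ fun ω => ?_)
  dsimp only
  rw [dartPhaseSum_faceAt_eq hE hδ ω v c]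
  exact Finset.sum_congr rfl fun n _ => (orbitPhase_eq_zeta0_zpow _ _ n).symm

/-! ### Sub-goal 2: unit fugacity -/

/-- **Darts are not repeated**: for admissible data, at most one position of the exploration path traverses a
given medial dart `s → t` (the list of consecutive pairs `γ.zip γ.tail` has no duplicates,
`IsMedialExploration.nodup`). -/
theorem card_dartFilter_le_one {E : DiscreteDobrushin} (hE : E.IsZdAdmissible) (ω : BondConfig (Site 2))
    (s t : MedialVertex) :
    ((Finset.range (medialExploration E ω).length).filter (fun k => (medialExploration E ω)[k]? = some s ∧
      (medialExploration E ω)[k + 1]? = some t)).card ≤ 1 := by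
  have hnd := (isMedialExploration_medialExploration_holds E hE ω).nodup
  rw [List.nodup_iff_getElem?_ne_getElem?] at hnd
  rw [Finset.card_le_one]
  intro a ha b hb
  simp only [Finset.mem_filter, Finset.mem_range] at ha hb
  have hz : ∀ {i : ℕ}, (medialExploration E ω)[i]? = some s → (medialExploration E ω)[i + 1]? = some t →
      ((medialExploration E ω).zip (medialExploration E ω).tail)[i]? = some (s, t) :=
    fun h1 h2 => List.getElem?_zip_eq_some.2 ⟨h1, by rw [List.getElem?_tail]; exact h2⟩
  have hza := hz ha.2.1 ha.2.2
  have hzb := hz hb.2.1 hb.2.2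
  have hlen : ∀ {i : ℕ}, ((medialExploration E ω).zip (medialExploration E ω).tail)[i]? = some (s, t) →
      i < ((medialExploration E ω).zip (medialExploration E ω).tail).length := by
    intro i hi
    obtain ⟨hi', -⟩ := List.getElem?_eq_some_iff.1 hi
    exact hi'
  by_contra hab
  rcases lt_or_gt_of_ne hab with hlt | hlt
  · exact hnd a b hlt (hlen hzb) (hza.trans hzb.symm)
  · exact hnd b a hlt (hlen hza) (hzb.trans hza.symm)

/-- **The passage event is measurable**: whether the exploration traverses the dart `s → t` reads only the
finitely many edges of `Ω_δ` (`medialExploration_inter_edgeSet`). -/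
theorem measurableSet_passage {E : DiscreteDobrushin} (hE : E.IsZdAdmissible) (s t : MedialVertex) :
    MeasurableSet {ω : BondConfig (Site 2) | ∃ k, (medialExploration E ω)[k]? = some s ∧
      (medialExploration E ω)[k + 1]? = some t} :=
  measurableSet_setOf.2 (measurable_of_forall_inter (edgeSet_finite hE)
    (F := fun ω : BondConfig (Site 2) => ∃ k, (medialExploration E ω)[k]? = some s ∧
      (medialExploration E ω)[k + 1]? = some t)
    (fun ω => by simp only [medialExploration_inter_edgeSet]))

/-- **The number of passages is the indicator of the passage event** (darts are not repeated). -/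
theorem card_dartFilter_eq_indicator {E : DiscreteDobrushin} (hE : E.IsZdAdmissible) (ω : BondConfig (Site 2))
    (s t : MedialVertex) :
    ((((Finset.range (medialExploration E ω).length).filter (fun k => (medialExploration E ω)[k]? = some s ∧
      (medialExploration E ω)[k + 1]? = some t)).card : ℕ) : ℂ) =
      {ω : BondConfig (Site 2) | ∃ k, (medialExploration E ω)[k]? = some s ∧
        (medialExploration E ω)[k + 1]? = some t}.indicator (fun _ => (1 : ℂ)) ω := by
  by_cases hω : ω ∈ {ω : BondConfig (Site 2) | ∃ k, (medialExploration E ω)[k]? = some s ∧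
      (medialExploration E ω)[k + 1]? = some t}
  · rw [Set.indicator_of_mem hω]
    obtain ⟨k, hk1, hk2⟩ := hω
    have hmem : k ∈ (Finset.range (medialExploration E ω).length).filter (fun k =>
        (medialExploration E ω)[k]? = some s ∧ (medialExploration E ω)[k + 1]? = some t) := by
      obtain ⟨hk, -⟩ := List.getElem?_eq_some_iff.1 hk1
      exact Finset.mem_filter.2 ⟨Finset.mem_range.2 hk, hk1, hk2⟩
    have hcard : ((Finset.range (medialExploration E ω).length).filter (fun k =>
        (medialExploration E ω)[k]? = some s ∧ (medialExploration E ω)[k + 1]? = some t)).card = 1 :=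
      le_antisymm (card_dartFilter_le_one hE ω s t) (Finset.card_pos.2 ⟨k, hmem⟩)
    rw [hcard, Nat.cast_one]
  · rw [Set.indicator_of_notMem hω]
    have hempty : (Finset.range (medialExploration E ω).length).filter (fun k =>
        (medialExploration E ω)[k]? = some s ∧ (medialExploration E ω)[k + 1]? = some t) = ∅ :=
      Finset.filter_eq_empty_iff.2 fun k _ hk => hω ⟨k, hk⟩
    rw [hempty, Finset.card_empty, Nat.cast_zero]

/-- **Sub-goal `classGF_one_eq_passageProb`** (registered sub-goal of line `Sketch`, composition `LeeYang`): for
admissible data (any reading mesh), the class-`c` generating function at unit fugacity is the probability that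
the exploration interface traverses the dart `(v, faceAt v c)`: at `ζ = 1` the integrand is the number of
passages, which is the indicator of the passage event (`card_dartFilter_eq_indicator`). -/
theorem classGF_one_eq_passageProb : ∀ (E : DiscreteDobrushin) (δ : ℝ) (v : Site 2) (c : Fin 4), E.IsZdAdmissible → classGF E δ v c 1 = (((bondPercolation (zdGraph 2) half).real {ω | ∃ k, (medialExploration E ω)[k]? = some (cornerSource v (faceAt v c)) ∧ (medialExploration E ω)[k + 1]? = some (cornerTarget v (faceAt v c))} : ℝ) : ℂ) := by
  intro E δ v c hE
  unfold classGF
  simp only [one_zpow, Finset.sum_const, Nat.smul_one_eq_cast]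
  simp_rw [card_dartFilter_eq_indicator hE]
  rw [integral_indicator_const _ (measurableSet_passage hE _ _), Complex.real_smul, mul_one]

end Summit.CriticalPhenomena.CardyFormulaZ2.Cruxes.EdgeCoherence.LeeYang

end
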